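/-
Copyright (c) 2026 the pub-hodgecm-mathlib formalisation cell (harness21).  Prover seat hodgecm-mathlib-K2E3-p14 (g10) (E3 hand on strike line L1; LEAD F0P6-plan (g15)
BATCH #198 (a) «(F-arch)» follow-on), Track B «K2-LIT» ∕ hLiu418 = `stmt-HodgeConjecture-24832`: U1-glob LEVEL 2-fin, the ARCH-KERNEL branch — (F-tail-arch) FILE 3:
`stdExtension 𝒦 s₀ (a ⊗_∞ b)` IS PURE IN THE ARCH SLOT on the slice (the arch twin of ★ B2b FILE 3 p863166 `K2LiuStdExtensionPureAt`).  THEOREMS ONLY (no `def` ∕ `instance` ∕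
notation ∕ named-fact hypothesis ∕ `sorry`).
-/
import Summits.HodgeConjecture.HodgeConjecture.Theorems.K2LiuStdFamilyAwayPurityFlat   -- ★ (E6′) (K2Liu-p03): `heightTwistArch_siegel`, `heightArch_mul_of_mem`; brings ★ (E6) `modDelta_pPart_placesEmbed`, ★ prelims
import Mathlib.Data.Fintype.BigOperators
import HarnessLib

/-!
# Crux `HLiu418`, U1-glob LEVEL 2-fin, arch-kernel branch — (F-tail-arch) FILE 3: `stdExtension 𝒦 s₀ (a ⊗_∞ b)` IS PURE IN THE ARCH SLOT ON THE SLICE — the `hpure` letter of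
# ★ (F-tail-arch) FILE 1 `K2LiuSingularWhittakerArchFactorEuler.whittakerDelta_eq_archFactor_mul_of_pureArch`, with `bA :=` the arch flat family `H_∞(·)^{2(s−s₀)}·b`

Cell `hodgecm-mathlib`, crux item hLiu418 = `stmt-HodgeConjecture-24832`; squad K2, strike line L1, LEAD F0P6-plan (g15); U1 desk K2E3-p28 (g3); END pen K2E3-p32 (g3);
prover K2E3-p14 (g10).  Lane `--supports stmt-HodgeConjecture-24832 --as helper` (count-neutral).  THEOREMS ONLY.

THE POINT ((F-arch) ★ p863937's by-value letter `htail∞`, third link).  ★ #31s `K2LiuStdFamilyFactorisable.stdFamilyFactorisable` makes a standard family `f` factorizable off `T` with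
HEAD `fT s x := f s (placesEmbed_T x)`; ★ (F-tail-arch) FILE 1 wants that head PURE IN THE ARCH SLOT: `fT s (y_∞, y) = bA s y_∞ · rT s y`.  For U1-glob(σ)'s ONE pure term
`φ h = a (h_f) · b (h_∞)` (`b` a `K_∞`-finite archimedean section carrying the kernel vector at the real place `σ`, `a` the away (finite-adelic) section) and `f := stdExtension 𝒦 s₀ φ`
(★ `f s h = M(h)^{2(s−s₀)} · φ h`, `M := modDelta ∘ 𝒦.pPart`), this file proves it with THE ARCH FACTOR OF RECORD
  `bA s y_∞ := H_∞(y_∞)^{2(s−s₀)} · b y_∞`,   `H_∞(y_∞) := M((y_∞, 1))`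
— exactly ★ (E6′) `K2LiuStdFamilyAwayPurityFlat`'s arch flat family (`heightTwistArch_*`) — and `rT s y := M(X)^{2(s−s₀)} · a (X_f)`, `X := placesEmbed_T (1, y)`, `X_f = placesEmbedFin_T y`:
* §1 **`stdExtension_placesEmbed_eq_mul_of_pureArch`** — for `𝒦` standard (+ the level guard `(𝒦.K)_v ⊆ K_{H,v}` off `T` of ★ (E6)) and `φ` pure at `∞` as above:
  `stdExtension 𝒦 s₀ φ s (placesEmbed_T (y_∞, y)) = (H_∞(y_∞)^{2(s−s₀)} · b y_∞) · (M(X)^{2(s−s₀)} · a (placesEmbedFin_T y))` — ★ (F-tail-arch) FILE 1's `hpure` TOKEN FOR TOKEN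
  (`bA`, `rT` explicit).  MECHANISM: `(placesEmbed_T (y_∞, y))_∞ = y_∞`, `(placesEmbed_T (y_∞, y))_f = placesEmbedFin_T y` (★ prelims); the height splits `M(placesEmbed_T (y_∞, y)) = H_∞(y_∞) · ∏_{v∈T} M(ι_v y_v)` by ★ (E6)
  `modDelta_pPart_placesEmbed` (applied to `(y_∞, y)` and to `(1, y)`, `M((1,1)) = 1`) — no local Iwasawa data, no saturation hypothesis.
* §2 **`exists_pureArch_placesEmbed_flat`** — the same packaged with the FLAT-FAMILY LETTERS OF `bA` exported as conjuncts: the archimedean Siegel law at every `s` from the law at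
  `s₀` (★ `heightTwistArch_siegel`), flat on `(·,1)⁻¹(𝒦.K)` (★ `IwasawaDatum.modDelta_pPart_of_mem_K`), `bA s₀ = b`, and the defining formula.
References: [Tan1999] V. Tan, Canad. J. Math. 51 (1999), §1 p. 166 (`Φ(g,s) = Φ_v ⊗ Φ^v`); [KudlaRallis1994] §1; [HarrisKudlaSweet1996] §1 (1.15)–(1.17); [BorelJacquet1979] §4.1;
[KudlaSweet1997] §1 (flat = standard sections).
HONEST LABEL.  Count-neutral helper: `HC_CM` is proved only modulo the 7 printed citations (2 remaining named inputs: hLiu418 = `stmt-HodgeConjecture-24832`,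
h413 = `stmt-HodgeConjecture-24833`) until rung 0 closes; U1-glob LEVEL 2 stays OPEN (FILE B; the arch branch's `hdead∞`).
-/

set_option autoImplicit false
set_option linter.dupNamespace false -- the mandated namespace repeats `HodgeConjecture.HodgeConjecture`

noncomputable section

open scoped Matrix RestrictedProduct BigOperators
open Filter Topology Set NumberField IsDedekindDomain
open Literature.NumberTheory.Automorphic Literature.NumberTheory.Automorphic.UnitaryGroup Literature.NumberTheory.GaloisRepresentations
open Literature.NumberTheory.GelbartRogawski1991 Literature.NumberTheory.GelbartRogawski1991.GRConstruction
open Literature.NumberTheory.GelbartRogawski1991.UnitaryDualPair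
open Literature.NumberTheory.K2Lit.SiegelDoubled Literature.NumberTheory.K2Lit.LocalSiegelDoubled Literature.NumberTheory.K2Lit.PlaceSplitting
open Summit.HodgeConjecture.HodgeConjecture.Cruxes.HLiu418.K2LiuStdFamilyFactorisable
open Summit.HodgeConjecture.HodgeConjecture.Cruxes.HLiu418.K2LiuIwasawaDeltaUnimodular
open Summit.HodgeConjecture.HodgeConjecture.Cruxes.HLiu418.K2LiuSiegelBigCellSectionOfLocalPrelims
open Summit.HodgeConjecture.HodgeConjecture.Cruxes.HLiu418.K2LiuIwasawaHeightPlaceFactorisation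
open Summit.HodgeConjecture.HodgeConjecture.Cruxes.HLiu418.K2LiuStdFamilyAwayPurityFlat

namespace Summit.HodgeConjecture.HodgeConjecture.Cruxes.HLiu418.K2LiuStdExtensionPureArch

/-! ## §1 The standard extension of a section pure at `∞` is pure in the arch slot on the slice -/

variable (L : Type) [Field L] [NumberField L] [IsCMField L]
variable {N M n : ℕ} (e : Fin N × Fin M ≃ Fin n)
  (dV : Fin N → L) (hdV : ∀ i, IsCMField.complexConj L (dV i) = dV i) (hdV0 : ∀ i, dV i ≠ 0)
  (dW : Fin M → L) (hdW : ∀ i, IsCMField.complexConj L (dW i) = dW i) (hdW0 : ∀ i, dW i ≠ 0)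
  (T : Finset (HeightOneSpectrum (𝓞 (Fp L)))) [DecidableEq (HeightOneSpectrum (𝓞 (Fp L)))]

set_option maxHeartbeats 800000 in -- MEASURED class of ★ B2b FILE 3 §1 (`whnf` on the statement's adelic telescope + `isDefEq` at the height split: 400 000 ✗, 800 000 = ★ (E6)∕(E6′)'s class); `rw`∕`exact` only
include hdV0 hdW0 in
/-- **THE STANDARD EXTENSION OF A SECTION PURE AT `∞` IS PURE IN THE ARCH SLOT ON THE SLICE.**  `𝒦` standard with `(𝒦.K)_v ⊆ K_{H,v}` off `T` (★ (E6)'s guard),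
`φ h = a (h_f) · b (h_∞)` for all `h` (pure at `∞`).  Then for every `s, y_∞, y`:
`stdExtension 𝒦 s₀ φ s (placesEmbed_T (y_∞, y)) = (H_∞(y_∞)^{2(s−s₀)} · b y_∞) · (M(X)^{2(s−s₀)} · a (placesEmbedFin_T y))`, `X := placesEmbed_T (1, y)`, `H_∞(y_∞) := M((y_∞, 1))`,
`M := modDelta ∘ 𝒦.pPart` — ★ (F-tail-arch) FILE 1's `hpure` with `bA s y_∞ := H_∞(y_∞)^{2(s−s₀)} · b y_∞` (★ (E6′)'s arch flat family) and `rT s y := M(X)^{2(s−s₀)} · a (placesEmbedFin_T y)`.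
[cite: Tan1999, §1 p. 166] [cite: KudlaRallis1994, §1] [cite: HarrisKudlaSweet1996, §1 (1.17)] [cite: BorelJacquet1979, §4.1] -/
theorem stdExtension_placesEmbed_eq_mul_of_pureArch {𝒦 : IwasawaDatum L e dV hdV dW hdW} (h𝒦 : 𝒦.IsStd)
    (hKT : ∀ k ∈ 𝒦.K, ∀ v, v ∉ T → UnitaryGroup.evalPlace (Fp L) L (IsCMField.complexConj L) (n + n) (hermD L e dV hdV dW hdW) v (UnitaryGroup.finPart (Fp L) L (IsCMField.complexConj L) (n + n) (hermD L e dV hdV dW hdW) k) ∈ UnitaryGroup.localInt L (IsCMField.complexConj L) (n + n) (hermD L e dV hdV dW hdW) v)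
    (s₀ : ℂ) {φ : HA L e dV hdV dW hdW → ℂ} {a : UnitaryGroup.finAdelic (Fp L) L (IsCMField.complexConj L) (n + n) (hermD L e dV hdV dW hdW) → ℂ}
    {b : UnitaryGroup.arch (Fp L) L (IsCMField.complexConj L) (n + n) (hermD L e dV hdV dW hdW) → ℂ}
    (hφ : ∀ h : HA L e dV hdV dW hdW, φ h = a (UnitaryGroup.finPart (Fp L) L (IsCMField.complexConj L) (n + n) (hermD L e dV hdV dW hdW) h) * b (UnitaryGroup.archPart (Fp L) L (IsCMField.complexConj L) (n + n) (hermD L e dV hdV dW hdW) h))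
    (s : ℂ) (yi : UnitaryGroup.arch (Fp L) L (IsCMField.complexConj L) (n + n) (hermD L e dV hdV dW hdW))
    (y : Π v : T, UnitaryGroup.localPi L (IsCMField.complexConj L) (n + n) (hermD L e dV hdV dW hdW) v.1) :
    stdExtension 𝒦 s₀ φ s (placesEmbed L (hermD L e dV hdV dW hdW) T (yi, y)) =
      ((((modDelta L e dV hdV dW hdW (𝒦.pPart (UnitaryGroup.archToAdelic (Fp L) L (IsCMField.complexConj L) (n + n) (hermD L e dV hdV dW hdW) yi))) : ℝ) : ℂ) ^ (2 * (s - s₀)) * b yi) *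
        ((((modDelta L e dV hdV dW hdW (𝒦.pPart (placesEmbed L (hermD L e dV hdV dW hdW) T
              ((1 : UnitaryGroup.arch (Fp L) L (IsCMField.complexConj L) (n + n) (hermD L e dV hdV dW hdW)), y)))) : ℝ) : ℂ) ^ (2 * (s - s₀)) *
          a (placesEmbedFin L (hermD L e dV hdV dW hdW) T y)) := by
  -- the two slice points, read in `H(𝔸)` (★ (E6)'s typing discipline: name them as elements of `HA`)
  obtain ⟨X, hX⟩ : ∃ X : HA L e dV hdV dW hdW, X = placesEmbed L (hermD L e dV hdV dW hdW) T
      ((1 : UnitaryGroup.arch (Fp L) L (IsCMField.complexConj L) (n + n) (hermD L e dV hdV dW hdW)), y) := ⟨_, rfl⟩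
  obtain ⟨h₀, hh₀⟩ : ∃ h₀ : HA L e dV hdV dW hdW, h₀ = placesEmbed L (hermD L e dV hdV dW hdW) T (yi, y) := ⟨_, rfl⟩
  -- (1) the archimedean component and the finite part of the slice point
  have harch : UnitaryGroup.archPart (Fp L) L (IsCMField.complexConj L) (n + n) (hermD L e dV hdV dW hdW) h₀ = yi := by
    rw [hh₀]; exact archPart_placesEmbed L e dV hdV dW hdW T yi y
  have hfin : UnitaryGroup.finPart (Fp L) L (IsCMField.complexConj L) (n + n) (hermD L e dV hdV dW hdW) h₀ = placesEmbedFin L (hermD L e dV hdV dW hdW) T y := by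
    rw [hh₀]; exact finPart_placesEmbed L e dV hdV dW hdW T yi y
  -- (2) the height splits: `M(h₀) = M(X) · H_∞(y_∞)`
  have hK : 𝒦.IsDeltaUnimodular := IwasawaDatum.modDelta_eq_one_of_mem L e dV hdV hdV0 dW hdW hdW0 𝒦
  have h1A : ((UnitaryGroup.archToAdelic (Fp L) L (IsCMField.complexConj L) (n + n) (hermD L e dV hdV dW hdW)
      (1 : UnitaryGroup.arch (Fp L) L (IsCMField.complexConj L) (n + n) (hermD L e dV hdV dW hdW))) : HA L e dV hdV dW hdW) = 1 := map_one _
  have hM1 : modDelta L e dV hdV dW hdW (𝒦.pPart (UnitaryGroup.archToAdelic (Fp L) L (IsCMField.complexConj L) (n + n) (hermD L e dV hdV dW hdW)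
      (1 : UnitaryGroup.arch (Fp L) L (IsCMField.complexConj L) (n + n) (hermD L e dV hdV dW hdW)))) = 1 := by
    rw [h1A]; exact IwasawaDatum.modDelta_pPart_of_mem_K hK 𝒦.K.one_mem
  have hM : modDelta L e dV hdV dW hdW (𝒦.pPart h₀) =
      modDelta L e dV hdV dW hdW (𝒦.pPart X) *
        modDelta L e dV hdV dW hdW (𝒦.pPart (UnitaryGroup.archToAdelic (Fp L) L (IsCMField.complexConj L) (n + n) (hermD L e dV hdV dW hdW) yi)) := by
    rw [hh₀, hX, modDelta_pPart_placesEmbed L e dV hdV hdV0 dW hdW hdW0 T h𝒦 hKT yi y,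
      modDelta_pPart_placesEmbed L e dV hdV hdV0 dW hdW hdW0 T h𝒦 hKT (1 : UnitaryGroup.arch (Fp L) L (IsCMField.complexConj L) (n + n) (hermD L e dV hdV dW hdW)) y,
      hM1, one_mul, mul_comm]
  -- (3) assemble
  rw [← hh₀, ← hX, stdExtension, hφ h₀, harch, hfin, hM, Complex.ofReal_mul,
    Complex.mul_cpow_ofReal_nonneg (modDelta_pos L e dV hdV dW hdW _).le (modDelta_pos L e dV hdV dW hdW _).le]
  ring

/-! ## §2 The same with the flat-family letters of the arch factor exported -/

set_option maxHeartbeats 800000 in -- MEASURED class of §1's statement telescope plus the arch Siegel-law letter (★ `heightTwistArch_siegel`'s binder)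
include hdV0 hdW0 in
/-- **`hpure` WITH `bA` IDENTIFIED AS THE ARCH FLAT FAMILY THROUGH `b` (letters exported as conjuncts).**  Under §1's hypotheses and the archimedean Siegel law of `b` at `s₀`
(`hb`: `b (p_∞ · x) = χ_{s₀}(p) · b x` for `p ∈ P_Δ(𝔸)` with `p_f = 1`): there are `bA`, `rT` with (i) ★ (F-tail-arch) FILE 1's `hpure`:
`stdExtension 𝒦 s₀ φ s (placesEmbed_T (y_∞, y)) = bA s y_∞ · rT s y` for all `s, y_∞, y`; (ii) `bA s` keeps the archimedean Siegel law AT `s` for EVERY `s` (★ `heightTwistArch_siegel`);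
(iii) `bA` is FLAT on `(·,1)⁻¹(𝒦.K)`: `(a₀, 1) ∈ 𝒦.K → bA s a₀ = bA s' a₀`; (iv) `bA s₀ = b`; (v) the formula `bA s y_∞ = H_∞(y_∞)^{2(s−s₀)} · b y_∞`.
[cite: KudlaSweet1997, §1] [cite: Tan1999, §1 p. 166] [cite: HarrisKudlaSweet1996, §1 (1.15)–(1.17)] -/
theorem exists_pureArch_placesEmbed_flat {𝒦 : IwasawaDatum L e dV hdV dW hdW} (h𝒦 : 𝒦.IsStd)
    (hKT : ∀ k ∈ 𝒦.K, ∀ v, v ∉ T → UnitaryGroup.evalPlace (Fp L) L (IsCMField.complexConj L) (n + n) (hermD L e dV hdV dW hdW) v (UnitaryGroup.finPart (Fp L) L (IsCMField.complexConj L) (n + n) (hermD L e dV hdV dW hdW) k) ∈ UnitaryGroup.localInt L (IsCMField.complexConj L) (n + n) (hermD L e dV hdV dW hdW) v)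
    {χ : HeckeCharacter L} (s₀ : ℂ) {φ : HA L e dV hdV dW hdW → ℂ} {a : UnitaryGroup.finAdelic (Fp L) L (IsCMField.complexConj L) (n + n) (hermD L e dV hdV dW hdW) → ℂ}
    {b : UnitaryGroup.arch (Fp L) L (IsCMField.complexConj L) (n + n) (hermD L e dV hdV dW hdW) → ℂ}
    (hb : ∀ p : HA L e dV hdV dW hdW, IsSiegelDelta L e dV hdV dW hdW p → UnitaryGroup.finPart (Fp L) L (IsCMField.complexConj L) (n + n) (hermD L e dV hdV dW hdW) p = 1 →
      ∀ x : UnitaryGroup.arch (Fp L) L (IsCMField.complexConj L) (n + n) (hermD L e dV hdV dW hdW),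
        b (UnitaryGroup.archPart (Fp L) L (IsCMField.complexConj L) (n + n) (hermD L e dV hdV dW hdW) p * x) = siegelDeltaCharacter L e dV hdV dW hdW χ s₀ p * b x)
    (hφ : ∀ h : HA L e dV hdV dW hdW, φ h = a (UnitaryGroup.finPart (Fp L) L (IsCMField.complexConj L) (n + n) (hermD L e dV hdV dW hdW) h) * b (UnitaryGroup.archPart (Fp L) L (IsCMField.complexConj L) (n + n) (hermD L e dV hdV dW hdW) h)) :
    ∃ (bA : ℂ → UnitaryGroup.arch (Fp L) L (IsCMField.complexConj L) (n + n) (hermD L e dV hdV dW hdW) → ℂ)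
      (rT : ℂ → (Π v : T, UnitaryGroup.localPi L (IsCMField.complexConj L) (n + n) (hermD L e dV hdV dW hdW) v.1) → ℂ),
      (∀ (s : ℂ) (yi : UnitaryGroup.arch (Fp L) L (IsCMField.complexConj L) (n + n) (hermD L e dV hdV dW hdW))
          (y : Π v : T, UnitaryGroup.localPi L (IsCMField.complexConj L) (n + n) (hermD L e dV hdV dW hdW) v.1),
        stdExtension 𝒦 s₀ φ s (placesEmbed L (hermD L e dV hdV dW hdW) T (yi, y)) = bA s yi * rT s y) ∧
      (∀ (s : ℂ) (p : HA L e dV hdV dW hdW), IsSiegelDelta L e dV hdV dW hdW p → UnitaryGroup.finPart (Fp L) L (IsCMField.complexConj L) (n + n) (hermD L e dV hdV dW hdW) p = 1 →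
        ∀ x : UnitaryGroup.arch (Fp L) L (IsCMField.complexConj L) (n + n) (hermD L e dV hdV dW hdW),
          bA s (UnitaryGroup.archPart (Fp L) L (IsCMField.complexConj L) (n + n) (hermD L e dV hdV dW hdW) p * x) = siegelDeltaCharacter L e dV hdV dW hdW χ s p * bA s x) ∧
      (∀ (s s' : ℂ) (a₀ : UnitaryGroup.arch (Fp L) L (IsCMField.complexConj L) (n + n) (hermD L e dV hdV dW hdW)),
        (UnitaryGroup.archToAdelic (Fp L) L (IsCMField.complexConj L) (n + n) (hermD L e dV hdV dW hdW) a₀ : HA L e dV hdV dW hdW) ∈ 𝒦.K → bA s a₀ = bA s' a₀) ∧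
      bA s₀ = b ∧
      (∀ (s : ℂ) (yi : UnitaryGroup.arch (Fp L) L (IsCMField.complexConj L) (n + n) (hermD L e dV hdV dW hdW)),
        bA s yi = ((modDelta L e dV hdV dW hdW (𝒦.pPart (UnitaryGroup.archToAdelic (Fp L) L (IsCMField.complexConj L) (n + n) (hermD L e dV hdV dW hdW) yi)) : ℝ) : ℂ) ^ (2 * (s - s₀)) * b yi) := by
  have hK : 𝒦.IsDeltaUnimodular := IwasawaDatum.modDelta_eq_one_of_mem L e dV hdV hdV0 dW hdW hdW0 𝒦
  refine ⟨fun s yi => ((modDelta L e dV hdV dW hdW (𝒦.pPart (UnitaryGroup.archToAdelic (Fp L) L (IsCMField.complexConj L) (n + n) (hermD L e dV hdV dW hdW) yi)) : ℝ) : ℂ) ^ (2 * (s - s₀)) * b yi,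
    fun s y => ((modDelta L e dV hdV dW hdW (𝒦.pPart (placesEmbed L (hermD L e dV hdV dW hdW) T
        ((1 : UnitaryGroup.arch (Fp L) L (IsCMField.complexConj L) (n + n) (hermD L e dV hdV dW hdW)), y))) : ℝ) : ℂ) ^ (2 * (s - s₀)) *
      a (placesEmbedFin L (hermD L e dV hdV dW hdW) T y),
    fun s yi y => ?_, fun s => heightTwistArch_siegel L e dV hdV hdV0 dW hdW hdW0 𝒦 hb s, fun s s' a₀ ha₀ => ?_, ?_, fun s yi => rfl⟩
  · exact stdExtension_placesEmbed_eq_mul_of_pureArch L e dV hdV hdV0 dW hdW hdW0 T h𝒦 hKT s₀ hφ s yi y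
  · show ((modDelta L e dV hdV dW hdW (𝒦.pPart (UnitaryGroup.archToAdelic (Fp L) L (IsCMField.complexConj L) (n + n) (hermD L e dV hdV dW hdW) a₀)) : ℝ) : ℂ) ^ (2 * (s - s₀)) * b a₀ =
      ((modDelta L e dV hdV dW hdW (𝒦.pPart (UnitaryGroup.archToAdelic (Fp L) L (IsCMField.complexConj L) (n + n) (hermD L e dV hdV dW hdW) a₀)) : ℝ) : ℂ) ^ (2 * (s' - s₀)) * b a₀
    rw [IwasawaDatum.modDelta_pPart_of_mem_K hK ha₀, Complex.ofReal_one, Complex.one_cpow, Complex.one_cpow]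
  · funext u
    show ((modDelta L e dV hdV dW hdW (𝒦.pPart (UnitaryGroup.archToAdelic (Fp L) L (IsCMField.complexConj L) (n + n) (hermD L e dV hdV dW hdW) u)) : ℝ) : ℂ) ^ (2 * (s₀ - s₀)) * b u = b u
    rw [sub_self, mul_zero, Complex.cpow_zero, one_mul]

end Summit.HodgeConjecture.HodgeConjecture.Cruxes.HLiu418.K2LiuStdExtensionPureArch

end
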